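import Summits.CriticalPhenomena.PercolationContinuityZ3.Theorems.PercNearOneGluingNoHeavyConstsClusterSquareMinorBridge
import HarnessLib

/-!
# Two crossing linkages give a rooted 4-cycle minor

builds on p205010 (kernel theorem, internal audit signed; external expert review pending)

PAPER-2 track "percolation constants", part (ii), seat `prim-consts-1`, gen 23 (lane index
`run/shared/lean/prim/consts/CONSTANTS.md`, row A19; memo `FROM-prim-consts-1-g23-SERIES-PARALLEL.md` §3).
Support file for the crux `NoHeavyLowerTail` (stmt-CriticalPhenomena-4575; `--supports`).  Theorems only (pure graph theory);
no definitions, no sorries.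

**THE LEMMA (`Consts.Minor.rootedC4_of_crossLinkages`).**  Let `b, y, c, y'` be vertices of a graph `H` with vertex-disjoint walks
`P₁ : b → y ∥ P₂ : c → y'` and vertex-disjoint walks `P₃ : b → y' ∥ P₄ : c → y` (the two "adjacent" pairings of the cyclic order
`(b, y, c, y')` are linked).  Then `H` has a ROOTED `C₄` MINOR in the order `(b, y, c, y')`: pairwise disjoint vertex sets `B ∋ b`,
`X ∋ y`, `C ∋ c`, `X' ∋ y'`, each inducing a connected subgraph, with `B ~ X ~ C ~ X' ~ B`; moreover the four sets lie inside the
supports of the given walks.  (The converse is obvious, so "both adjacent pairings linked" characterises the rooted `C₄` minor.)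
PROOF (a contraction-free recursion, induction on `|P₃| + |P₄|`).  Keep bags `B = supp A₃` (a walk `b → b₃`, the consumed prefix of
`P₃`) and `C = supp A₄` (`c → c₄`, consumed prefix of `P₄`), the unconsumed paths `P₃ : b₃ → y'`, `P₄ : c₄ → y`, and suffixes
`P₁ : β → y`, `P₂ : γ → y'` of the first linkage with `β ∈ B`, `γ ∈ C`, under the invariants: `B` avoids `P₂, P₄` and meets `P₁, P₃` only
at `β, b₃`; `C` avoids `P₁, P₃` and meets `P₂, P₄` only at `γ, c₄`; `B ∩ C = P₁ ∩ P₂ = P₃ ∩ P₄ = ∅`.  Look at the first edges `b₃ ~ u`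
of `P₃` and `c₄ ~ v` of `P₄`.  If `u ∈ P₂` and `v ∈ P₁` the ring is `(B, P₁ ∖ β, C, P₂ ∖ γ)`.  Otherwise absorb `u` into `B`
(advancing `P₁` to start at `u` if `u ∈ P₁`) or `v` into `C`; the invariants persist and `|P₃| + |P₄|` drops.
USE (`…ConstsClusterSquareK33Cone.lean`): a DOUBLE clash at `(a; b, c)` (gen 17, `Consts.not_doubleClash_of_unlinked`: clash vertices
`y, y'` adjacent to `K = C_a(ω)`, walks `b–y ∥ c–y'` and `b–y' ∥ c–y` off `K`) gives the rooted `C₄` `(b, y, c, y')` off `K`, hence a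
`K₃,₃` minor `{K, B, C} ∣ {∞, X, X'}` of the CONE `H + ∞{a, b, c}` — so no double clash, hence CSQ/DUU/TS at `(a; b, c)`, whenever the
cone has no `K₃,₃` minor, in particular for PLANAR `H` with `a, b, c` on one face (Theorem D of the lane).
Census (lane g23, `prim-consts-1/g23/eng/rc4.py`, `fixpoint.py`): the lemma holds at all 7 360 344 quadruples `(b,y,c,y')` with both
linkages in the connected graphs on `≤ 8` vertices (0 failures); the recursion's output was checked on all 111 440 path systems with
`n ≤ 6`.  Minimal-length shortcuts do NOT work (a 9-vertex system where every length-minimal choice of the four paths has crossing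
bridges), hence the recursion.
References: R. Diestel, Graph Theory (5th ed.), §1.7 (minors as branch sets); N. Robertson, P. D. Seymour, Graph minors IX/XIII
(rooted structures; background only).
-/

namespace Summit.CriticalPhenomena.PercolationContinuityZ3.Theorems

namespace Consts

namespace Minor

variable {V : Type*} [DecidableEq V] {H : SimpleGraph V}

omit [DecidableEq V] in
/-- A vertex of a cons-walk's tail is not its head when the walk is a path. [folklore] -/
theorem not_mem_of_cons_isPath {u v w : V} {h : H.Adj u v} {p : H.Walk v w} (hp : (SimpleGraph.Walk.cons h p).IsPath) :
    u ∉ p.support := ((SimpleGraph.Walk.cons_isPath_iff h p).mp hp).2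

/-- **Rooted `C₄` minor from two crossing linkages — the recursion.**  See the file docstring for the invariants; `k` bounds
`P₃.length + P₄.length`. [cite: Diestel2017, §1.7 (minors as branch sets)] -/
theorem rootedC4_aux (b c y y' : V) (k : ℕ) :
    ∀ (β γ b₃ c₄ : V) (A₃ : H.Walk b b₃) (A₄ : H.Walk c c₄) (P₁ : H.Walk β y) (P₂ : H.Walk γ y')
      (P₃ : H.Walk b₃ y') (P₄ : H.Walk c₄ y),
      P₃.length + P₄.length ≤ k → P₁.IsPath → P₂.IsPath → P₃.IsPath → P₄.IsPath →
      β ∈ A₃.support → γ ∈ A₄.support →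
      (∀ x ∈ P₁.support, x ∉ P₂.support) → (∀ x ∈ P₃.support, x ∉ P₄.support) →
      (∀ x ∈ A₃.support, x ∉ A₄.support) →
      (∀ x ∈ A₃.support, x ∉ P₂.support) → (∀ x ∈ A₃.support, x ∉ P₄.support) →
      (∀ x ∈ A₃.support, x ∈ P₁.support → x = β) → (∀ x ∈ A₃.support, x ∈ P₃.support → x = b₃) →
      (∀ x ∈ A₄.support, x ∉ P₁.support) → (∀ x ∈ A₄.support, x ∉ P₃.support) →
      (∀ x ∈ A₄.support, x ∈ P₂.support → x = γ) → (∀ x ∈ A₄.support, x ∈ P₄.support → x = c₄) →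
      ∃ B X C X' : Set V,
        b ∈ B ∧ y ∈ X ∧ c ∈ C ∧ y' ∈ X' ∧
        (H.induce B).Connected ∧ (H.induce X).Connected ∧ (H.induce C).Connected ∧ (H.induce X').Connected ∧
        Disjoint B X ∧ Disjoint B C ∧ Disjoint B X' ∧ Disjoint X C ∧ Disjoint X X' ∧ Disjoint C X' ∧
        (∃ u ∈ B, ∃ v ∈ X, H.Adj u v) ∧ (∃ u ∈ X, ∃ v ∈ C, H.Adj u v) ∧ (∃ u ∈ C, ∃ v ∈ X', H.Adj u v) ∧
        (∃ u ∈ X', ∃ v ∈ B, H.Adj u v) ∧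
        (∀ x ∈ B, x ∈ A₃.support ∨ x ∈ P₃.support) ∧ (∀ x ∈ X, x ∈ P₁.support) ∧
        (∀ x ∈ C, x ∈ A₄.support ∨ x ∈ P₄.support) ∧ (∀ x ∈ X', x ∈ P₂.support) := by
  induction k with
  | zero =>
    intro β γ b₃ c₄ A₃ A₄ P₁ P₂ P₃ P₄ hk _ _ _ _ _ _ _ _ _ hB2
    intros
    -- `P₃` is trivial, so `b₃ = y' ∈ P₂`: contradicts `B ∩ P₂ = ∅`
    have h0 : P₃.length = 0 := by omega
    obtain rfl := SimpleGraph.Walk.eq_of_length_eq_zero h0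
    exact absurd P₂.end_mem_support (hB2 _ A₃.end_mem_support)
  | succ k ih =>
    intro β γ b₃ c₄ A₃ A₄ P₁ P₂ P₃ P₄ hk hP₁ hP₂ hP₃ hP₄ hβ hγ d12 d34 dBC hB2 hB4 hB1 hB3 hC1 hC3 hC2 hC4
    -- the first edges of `P₃` and `P₄`
    cases P₃ with
    | nil => exact absurd P₂.end_mem_support (hB2 _ A₃.end_mem_support)
    | cons hb₃u P₃' =>
    rename_i u
    cases P₄ with
    | nil => exact absurd P₁.end_mem_support (hC1 _ A₄.end_mem_support)
    | cons hc₄v P₄' =>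
    rename_i v
    have hP₃' : P₃'.IsPath := hP₃.of_cons
    have hP₄' : P₄'.IsPath := hP₄.of_cons
    have hb₃P₃' : b₃ ∉ P₃'.support := not_mem_of_cons_isPath hP₃
    have hc₄P₄' : c₄ ∉ P₄'.support := not_mem_of_cons_isPath hP₄
    have hu3 : u ∈ (SimpleGraph.Walk.cons hb₃u P₃').support := List.mem_cons_of_mem _ P₃'.start_mem_support
    have hv4 : v ∈ (SimpleGraph.Walk.cons hc₄v P₄').support := List.mem_cons_of_mem _ P₄'.start_mem_support
    have huA₃ : u ∉ A₃.support := fun h => hb₃P₃' ((hB3 u h hu3) ▸ P₃'.start_mem_support)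
    have hvA₄ : v ∉ A₄.support := fun h => hc₄P₄' ((hC4 v h hv4) ▸ P₄'.start_mem_support)
    have hu4 : u ∉ (SimpleGraph.Walk.cons hc₄v P₄').support := d34 u hu3
    have hv3 : v ∉ (SimpleGraph.Walk.cons hb₃u P₃').support := fun h => d34 v h hv4
    have huA₄ : u ∉ A₄.support := fun h => hC3 u h hu3
    have hvA₃ : v ∉ A₃.support := fun h => hB4 v h hv4
    have hβy : β ≠ y := fun h => hB4 β hβ (h ▸ (SimpleGraph.Walk.cons hc₄v P₄').end_mem_support)
    have hγy' : γ ≠ y' := fun h => hC3 γ hγ (h ▸ (SimpleGraph.Walk.cons hb₃u P₃').end_mem_support)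
    by_cases hu2 : u ∈ P₂.support
    · by_cases hv1 : v ∈ P₁.support
      · -- THE RING: `(supp A₃, P₁ ∖ β, supp A₄, P₂ ∖ γ)`
        obtain ⟨β₁, hββ₁, P₁t, hP₁t⟩ := exists_cons P₁ hβy
        obtain ⟨γ₁, hγγ₁, P₂t, hP₂t⟩ := exists_cons P₂ hγy'
        have hP₁t1 : ∀ x ∈ P₁t.support, x ∈ P₁.support := fun x hx => by rw [hP₁t]; exact List.mem_cons_of_mem _ hx
        have hP₂t2 : ∀ x ∈ P₂t.support, x ∈ P₂.support := fun x hx => by rw [hP₂t]; exact List.mem_cons_of_mem _ hx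
        have hβt : β ∉ P₁t.support := by
          intro h; have hnd := hP₁.support_nodup; rw [hP₁t, List.nodup_cons] at hnd; exact hnd.1 h
        have hγt : γ ∉ P₂t.support := by
          intro h; have hnd := hP₂.support_nodup; rw [hP₂t, List.nodup_cons] at hnd; exact hnd.1 h
        have hvt : v ∈ P₁t.support := by
          have h := hv1; rw [hP₁t, List.mem_cons] at h
          exact h.resolve_left fun e => hvA₃ (e ▸ hβ)
        have hut : u ∈ P₂t.support := by
          have h := hu2; rw [hP₂t, List.mem_cons] at h
          exact h.resolve_left fun e => huA₄ (e ▸ hγ)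
        refine ⟨{x | x ∈ A₃.support}, {x | x ∈ P₁t.support}, {x | x ∈ A₄.support}, {x | x ∈ P₂t.support},
          A₃.start_mem_support, P₁t.end_mem_support, A₄.start_mem_support, P₂t.end_mem_support,
          A₃.connected_induce_support, P₁t.connected_induce_support, A₄.connected_induce_support,
          P₂t.connected_induce_support, ?_, ?_, ?_, ?_, ?_, ?_,
          ⟨β, hβ, β₁, P₁t.start_mem_support, hββ₁⟩, ⟨v, hvt, c₄, A₄.end_mem_support, hc₄v.symm⟩,
          ⟨γ, hγ, γ₁, P₂t.start_mem_support, hγγ₁⟩, ⟨u, hut, b₃, A₃.end_mem_support, hb₃u.symm⟩,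
          fun x hx => Or.inl hx, fun x hx => hP₁t1 x hx, fun x hx => Or.inl hx, fun x hx => hP₂t2 x hx⟩
        · exact Set.disjoint_left.mpr fun x hx hx' => hβt ((hB1 x hx (hP₁t1 x hx')) ▸ hx')
        · exact Set.disjoint_left.mpr fun x hx hx' => dBC x hx hx'
        · exact Set.disjoint_left.mpr fun x hx hx' => hB2 x hx (hP₂t2 x hx')
        · exact Set.disjoint_left.mpr fun x hx hx' => hC1 x hx' (hP₁t1 x hx)
        · exact Set.disjoint_left.mpr fun x hx hx' => d12 x (hP₁t1 x hx) (hP₂t2 x hx')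
        · exact Set.disjoint_left.mpr fun x hx hx' => hγt ((hC2 x hx (hP₂t2 x hx')) ▸ hx')
      · -- ABSORB `v` INTO `C`
        have hlen : (SimpleGraph.Walk.cons hb₃u P₃').length + P₄'.length ≤ k := by
          simp only [SimpleGraph.Walk.length_cons] at hk ⊢; omega
        have hA₄' : ∀ x ∈ (A₄.concat hc₄v).support, x ∈ A₄.support ∨ x = v := fun x hx => by
          rw [SimpleGraph.Walk.support_concat, List.mem_append, List.mem_singleton] at hx
          rcases hx with hx | hx
          · exact Or.inl hx
          · exact Or.inr hx
        have hvA₄' : v ∈ (A₄.concat hc₄v).support := (A₄.concat hc₄v).end_mem_support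
        have hA₄sub : ∀ x ∈ A₄.support, x ∈ (A₄.concat hc₄v).support := fun x hx => by
          rw [SimpleGraph.Walk.support_concat, List.mem_append]; exact Or.inl hx
        have hP₄'4 : ∀ x ∈ P₄'.support, x ∈ (SimpleGraph.Walk.cons hc₄v P₄').support :=
          fun x hx => List.mem_cons_of_mem _ hx
        -- common invariants
        have d34' : ∀ x ∈ (SimpleGraph.Walk.cons hb₃u P₃').support, x ∉ P₄'.support :=
          fun x hx hx' => d34 x hx (hP₄'4 x hx')
        have dBC' : ∀ x ∈ A₃.support, x ∉ (A₄.concat hc₄v).support := fun x hx hx' => by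
          rcases hA₄' x hx' with h | rfl
          · exact dBC x hx h
          · exact hvA₃ hx
        have hB4' : ∀ x ∈ A₃.support, x ∉ P₄'.support := fun x hx hx' => hB4 x hx (hP₄'4 x hx')
        have hC1' : ∀ x ∈ (A₄.concat hc₄v).support, x ∉ P₁.support := fun x hx hx1 => by
          rcases hA₄' x hx with h | rfl
          · exact hC1 x h hx1
          · exact hv1 hx1
        have hC3' : ∀ x ∈ (A₄.concat hc₄v).support, x ∉ (SimpleGraph.Walk.cons hb₃u P₃').support := fun x hx hx3 => by
          rcases hA₄' x hx with h | rfl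
          · exact hC3 x h hx3
          · exact hv3 hx3
        have hC4' : ∀ x ∈ (A₄.concat hc₄v).support, x ∈ P₄'.support → x = v := fun x hx hx4 => by
          rcases hA₄' x hx with h | rfl
          · exact absurd ((hC4 x h (hP₄'4 x hx4)) ▸ hx4) hc₄P₄'
          · rfl
        have fin : ∀ (B X C X' : Set V), (∀ x ∈ C, x ∈ (A₄.concat hc₄v).support ∨ x ∈ P₄'.support) →
            ∀ x ∈ C, x ∈ A₄.support ∨ x ∈ (SimpleGraph.Walk.cons hc₄v P₄').support := by
          intro B X C X' hC x hx
          rcases hC x hx with h | h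
          · rcases hA₄' x h with h | rfl
            · exact Or.inl h
            · exact Or.inr hv4
          · exact Or.inr (hP₄'4 x h)
        by_cases hv2 : v ∈ P₂.support
        · -- `v` on `P₂`: advance `P₂` to start at `v`
          set P₂' := P₂.dropUntil v hv2 with hP₂'def
          have hP₂'2 : ∀ x ∈ P₂'.support, x ∈ P₂.support := fun x hx => P₂.support_dropUntil_subset_support hv2 hx
          have hγP₂' : γ ∉ P₂'.support := fun h =>
            hvA₄ ((takeUntil_dropUntil_disjoint P₂ hP₂ hv2 γ (P₂.takeUntil v hv2).start_mem_support h) ▸ hγ)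
          have hC2' : ∀ x ∈ (A₄.concat hc₄v).support, x ∈ P₂'.support → x = v := fun x hx hx2 => by
            rcases hA₄' x hx with h | rfl
            · exact absurd ((hC2 x h (hP₂'2 x hx2)) ▸ hx2) hγP₂'
            · rfl
          obtain ⟨B, X, C, X', hb, hy, hc, hy', cB, cX, cC, cX', e1, e2, e3, e4, e5, e6, a1, a2, a3, a4, sB, sX, sC, sX'⟩ :=
            ih β v b₃ v A₃ (A₄.concat hc₄v) P₁ P₂' (SimpleGraph.Walk.cons hb₃u P₃') P₄' hlen hP₁ (hP₂.dropUntil hv2) hP₃ hP₄'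
              hβ hvA₄' (fun x hx hx' => d12 x hx (hP₂'2 x hx')) d34' dBC' (fun x hx hx' => hB2 x hx (hP₂'2 x hx')) hB4' hB1
              hB3 hC1' hC3' hC2' hC4'
          exact ⟨B, X, C, X', hb, hy, hc, hy', cB, cX, cC, cX', e1, e2, e3, e4, e5, e6, a1, a2, a3, a4, sB, sX,
            fin B X C X' sC, fun x hx => hP₂'2 x (sX' x hx)⟩
        · have hC2' : ∀ x ∈ (A₄.concat hc₄v).support, x ∈ P₂.support → x = γ := fun x hx hx2 => by
            rcases hA₄' x hx with h | rfl
            · exact hC2 x h hx2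
            · exact absurd hx2 hv2
          obtain ⟨B, X, C, X', hb, hy, hc, hy', cB, cX, cC, cX', e1, e2, e3, e4, e5, e6, a1, a2, a3, a4, sB, sX, sC, sX'⟩ :=
            ih β γ b₃ v A₃ (A₄.concat hc₄v) P₁ P₂ (SimpleGraph.Walk.cons hb₃u P₃') P₄' hlen hP₁ hP₂ hP₃ hP₄'
              hβ (hA₄sub γ hγ) d12 d34' dBC' hB2 hB4' hB1 hB3 hC1' hC3' hC2' hC4'
          exact ⟨B, X, C, X', hb, hy, hc, hy', cB, cX, cC, cX', e1, e2, e3, e4, e5, e6, a1, a2, a3, a4, sB, sX,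
            fin B X C X' sC, sX'⟩
    · -- ABSORB `u` INTO `B` (mirror image)
      have hlen : P₃'.length + (SimpleGraph.Walk.cons hc₄v P₄').length ≤ k := by
        simp only [SimpleGraph.Walk.length_cons] at hk ⊢; omega
      have hA₃' : ∀ x ∈ (A₃.concat hb₃u).support, x ∈ A₃.support ∨ x = u := fun x hx => by
        rw [SimpleGraph.Walk.support_concat, List.mem_append, List.mem_singleton] at hx
        rcases hx with hx | hx
        · exact Or.inl hx
        · exact Or.inr hx
      have huA₃' : u ∈ (A₃.concat hb₃u).support := (A₃.concat hb₃u).end_mem_support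
      have hA₃sub : ∀ x ∈ A₃.support, x ∈ (A₃.concat hb₃u).support := fun x hx => by
        rw [SimpleGraph.Walk.support_concat, List.mem_append]; exact Or.inl hx
      have hP₃'3 : ∀ x ∈ P₃'.support, x ∈ (SimpleGraph.Walk.cons hb₃u P₃').support :=
        fun x hx => List.mem_cons_of_mem _ hx
      have d34' : ∀ x ∈ P₃'.support, x ∉ (SimpleGraph.Walk.cons hc₄v P₄').support := fun x hx => d34 x (hP₃'3 x hx)
      have dBC' : ∀ x ∈ (A₃.concat hb₃u).support, x ∉ A₄.support := fun x hx hx' => by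
        rcases hA₃' x hx with h | rfl
        · exact dBC x h hx'
        · exact huA₄ hx'
      have hB2' : ∀ x ∈ (A₃.concat hb₃u).support, x ∉ P₂.support := fun x hx hx2 => by
        rcases hA₃' x hx with h | rfl
        · exact hB2 x h hx2
        · exact hu2 hx2
      have hB4' : ∀ x ∈ (A₃.concat hb₃u).support, x ∉ (SimpleGraph.Walk.cons hc₄v P₄').support := fun x hx hx4 => by
        rcases hA₃' x hx with h | rfl
        · exact hB4 x h hx4
        · exact hu4 hx4
      have hB3' : ∀ x ∈ (A₃.concat hb₃u).support, x ∈ P₃'.support → x = u := fun x hx hx3 => by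
        rcases hA₃' x hx with h | rfl
        · exact absurd ((hB3 x h (hP₃'3 x hx3)) ▸ hx3) hb₃P₃'
        · rfl
      have hC3' : ∀ x ∈ A₄.support, x ∉ P₃'.support := fun x hx hx' => hC3 x hx (hP₃'3 x hx')
      have fin : ∀ (B : Set V), (∀ x ∈ B, x ∈ (A₃.concat hb₃u).support ∨ x ∈ P₃'.support) →
          ∀ x ∈ B, x ∈ A₃.support ∨ x ∈ (SimpleGraph.Walk.cons hb₃u P₃').support := by
        intro B hB x hx
        rcases hB x hx with h | h
        · rcases hA₃' x h with h | rfl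
          · exact Or.inl h
          · exact Or.inr hu3
        · exact Or.inr (hP₃'3 x h)
      by_cases hu1 : u ∈ P₁.support
      · set P₁' := P₁.dropUntil u hu1 with hP₁'def
        have hP₁'1 : ∀ x ∈ P₁'.support, x ∈ P₁.support := fun x hx => P₁.support_dropUntil_subset_support hu1 hx
        have hβP₁' : β ∉ P₁'.support := fun h =>
          huA₃ ((takeUntil_dropUntil_disjoint P₁ hP₁ hu1 β (P₁.takeUntil u hu1).start_mem_support h) ▸ hβ)
        have hB1' : ∀ x ∈ (A₃.concat hb₃u).support, x ∈ P₁'.support → x = u := fun x hx hx1 => by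
          rcases hA₃' x hx with h | rfl
          · exact absurd ((hB1 x h (hP₁'1 x hx1)) ▸ hx1) hβP₁'
          · rfl
        obtain ⟨B, X, C, X', hb, hy, hc, hy', cB, cX, cC, cX', e1, e2, e3, e4, e5, e6, a1, a2, a3, a4, sB, sX, sC, sX'⟩ :=
          ih u γ u c₄ (A₃.concat hb₃u) A₄ P₁' P₂ P₃' (SimpleGraph.Walk.cons hc₄v P₄') hlen (hP₁.dropUntil hu1) hP₂ hP₃' hP₄
            huA₃' hγ (fun x hx hx' => d12 x (hP₁'1 x hx) hx') d34' dBC' hB2' hB4' hB1' hB3'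
            (fun x hx hx1 => hC1 x hx (hP₁'1 x hx1)) hC3' hC2 hC4
        exact ⟨B, X, C, X', hb, hy, hc, hy', cB, cX, cC, cX', e1, e2, e3, e4, e5, e6, a1, a2, a3, a4, fin B sB,
          fun x hx => hP₁'1 x (sX x hx), sC, sX'⟩
      · have hB1' : ∀ x ∈ (A₃.concat hb₃u).support, x ∈ P₁.support → x = β := fun x hx hx1 => by
          rcases hA₃' x hx with h | rfl
          · exact hB1 x h hx1
          · exact absurd hx1 hu1
        obtain ⟨B, X, C, X', hb, hy, hc, hy', cB, cX, cC, cX', e1, e2, e3, e4, e5, e6, a1, a2, a3, a4, sB, sX, sC, sX'⟩ :=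
          ih β γ u c₄ (A₃.concat hb₃u) A₄ P₁ P₂ P₃' (SimpleGraph.Walk.cons hc₄v P₄') hlen hP₁ hP₂ hP₃' hP₄
            (hA₃sub β hβ) hγ d12 d34' dBC' hB2' hB4' hB1' hB3' hC1 hC3' hC2 hC4
        exact ⟨B, X, C, X', hb, hy, hc, hy', cB, cX, cC, cX', e1, e2, e3, e4, e5, e6, a1, a2, a3, a4, fin B sB, sX, sC, sX'⟩

/-- **Two crossing linkages give a rooted `C₄` minor.**  If `b → y ∥ c → y'` and `b → y' ∥ c → y` are both realised by
vertex-disjoint walks, then there are pairwise disjoint vertex sets `B ∋ b`, `X ∋ y`, `C ∋ c`, `X' ∋ y'`, each inducing a connected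
subgraph, joined cyclically `B ~ X ~ C ~ X' ~ B`, all inside the supports of the four walks.
[cite: Diestel2017, §1.7 (minors as branch sets)] -/
theorem rootedC4_of_crossLinkages {b c y y' : V} (R₁ : H.Walk b y) (R₂ : H.Walk c y') (R₃ : H.Walk b y') (R₄ : H.Walk c y)
    (h12 : ∀ x ∈ R₁.support, x ∉ R₂.support) (h34 : ∀ x ∈ R₃.support, x ∉ R₄.support) :
    ∃ B X C X' : Set V,
      b ∈ B ∧ y ∈ X ∧ c ∈ C ∧ y' ∈ X' ∧
      (H.induce B).Connected ∧ (H.induce X).Connected ∧ (H.induce C).Connected ∧ (H.induce X').Connected ∧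
      Disjoint B X ∧ Disjoint B C ∧ Disjoint B X' ∧ Disjoint X C ∧ Disjoint X X' ∧ Disjoint C X' ∧
      (∃ u ∈ B, ∃ v ∈ X, H.Adj u v) ∧ (∃ u ∈ X, ∃ v ∈ C, H.Adj u v) ∧ (∃ u ∈ C, ∃ v ∈ X', H.Adj u v) ∧
      (∃ u ∈ X', ∃ v ∈ B, H.Adj u v) ∧
      (∀ x ∈ B ∪ X ∪ C ∪ X', x ∈ R₁.support ∨ x ∈ R₂.support ∨ x ∈ R₃.support ∨ x ∈ R₄.support) := by
  -- pass to paths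
  set P₁ := R₁.bypass; set P₂ := R₂.bypass; set P₃ := R₃.bypass; set P₄ := R₄.bypass
  have s1 := R₁.support_bypass_subset_support; have s2 := R₂.support_bypass_subset_support
  have s3 := R₃.support_bypass_subset_support; have s4 := R₄.support_bypass_subset_support
  have hb2 : b ∉ P₂.support := fun h => h12 b R₁.start_mem_support (s2 h)
  have hb4 : b ∉ P₄.support := fun h => h34 b R₃.start_mem_support (s4 h)
  have hc1 : c ∉ P₁.support := fun h => h12 c (s1 h) R₂.start_mem_support
  have hc3 : c ∉ P₃.support := fun h => h34 c (s3 h) R₄.start_mem_support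
  have hbc : b ≠ c := fun h => hb2 (h ▸ P₂.start_mem_support)
  have nilb : ∀ x ∈ (SimpleGraph.Walk.nil : H.Walk b b).support, x = b := fun x hx => by
    rw [SimpleGraph.Walk.support_nil, List.mem_singleton] at hx; exact hx
  have nilc : ∀ x ∈ (SimpleGraph.Walk.nil : H.Walk c c).support, x = c := fun x hx => by
    rw [SimpleGraph.Walk.support_nil, List.mem_singleton] at hx; exact hx
  obtain ⟨B, X, C, X', hb, hy, hc, hy', cB, cX, cC, cX', e1, e2, e3, e4, e5, e6, a1, a2, a3, a4, sB, sX, sC, sX'⟩ :=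
    rootedC4_aux b c y y' (P₃.length + P₄.length) b c b c SimpleGraph.Walk.nil SimpleGraph.Walk.nil P₁ P₂ P₃ P₄ le_rfl
      R₁.bypass_isPath R₂.bypass_isPath R₃.bypass_isPath R₄.bypass_isPath (SimpleGraph.Walk.start_mem_support _)
      (SimpleGraph.Walk.start_mem_support _) (fun x hx hx' => h12 x (s1 hx) (s2 hx')) (fun x hx hx' => h34 x (s3 hx) (s4 hx'))
      (fun x hx hx' => hbc ((nilb x hx).symm.trans (nilc x hx'))) (fun x hx hx' => hb2 ((nilb x hx) ▸ hx'))
      (fun x hx hx' => hb4 ((nilb x hx) ▸ hx')) (fun x hx _ => nilb x hx) (fun x hx _ => nilb x hx)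
      (fun x hx hx' => hc1 ((nilc x hx) ▸ hx')) (fun x hx hx' => hc3 ((nilc x hx) ▸ hx')) (fun x hx _ => nilc x hx)
      (fun x hx _ => nilc x hx)
  refine ⟨B, X, C, X', hb, hy, hc, hy', cB, cX, cC, cX', e1, e2, e3, e4, e5, e6, a1, a2, a3, a4, fun x hx => ?_⟩
  rcases hx with ((hx | hx) | hx) | hx
  · rcases sB x hx with h | h
    · exact Or.inl ((nilb x h) ▸ R₁.start_mem_support)
    · exact Or.inr (Or.inr (Or.inl (s3 h)))
  · exact Or.inl (s1 (sX x hx))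
  · rcases sC x hx with h | h
    · exact Or.inr (Or.inl ((nilc x h) ▸ R₂.start_mem_support))
    · exact Or.inr (Or.inr (Or.inr (s4 h)))
  · exact Or.inr (Or.inl (s2 (sX' x hx)))

end Minor

end Consts

end Summit.CriticalPhenomena.PercolationContinuityZ3.Theorems
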